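import Summits.BirchSwinnertonDyer.BirchSwinnertonDyer.Theorems.SchneiderFreeAdditiveX3KrizLiHypothesisThreeAutomatic
import Summits.BirchSwinnertonDyer.BirchSwinnertonDyer.Theorems.SchneiderFreeAdditiveX3BranchIMCRebaseCovolume
import Summits.BirchSwinnertonDyer.Rank1Residual.Additive.RamifiedOrdinaryLineTransport
import Summits.BirchSwinnertonDyer.Rank1Residual.Additive.GordRamifiedOrdinaryLine
import Literature.NumberTheory.EllipticCurves.SerreOpenImageOrdinaryInertiaProofs
import Literature.NumberTheory.EllipticCurves.SerreOpenImageOfLocalInputProofs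
import HarnessLib

/-!
# Kriz–Li 2019 Thm. 1.20, hypothesis (1) at the prime `p` itself, Galois side: on the (G-ord, `e = 2`) cell of the K1 door
# (`W = C • V^{(p*)}`, `V` good ordinary at `p`) and `p ≥ 5`, the isogeny character `r` of every rational `p`-line of `W[p]` is,
# on the inertia group at `p`, either the Kummer sign `ε = χ_{p*}` or `ε · χ̄_p` — so BOTH `r` and `r⁻¹χ̄_p` are RAMIFIED at `p`
# (route `SchneiderFreeAdditiveX3`, Kriz–Li corner; general lemmas)

Cell `bsd-schneider-ideate`, seat `bsd-schneider-door-c5` (prover, generation 37; `--supports` 19177 as helper).  PARTITION: board row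
B6 ∩ X3 ∩ sst-twist, `r = 1`, (G-ord, `e = 2`) half at `p ≥ 5` (131 census pairs at `p = 5`, 16 at `7`, 2 at `13`, the `p = 37` row;
class-wide) — the KRIZ–LI SUB-LOCUS; types-the-object-of nothing new; closes none of B6's cells; BSD NOT advanced; «closes rung: none».
bears_on: K1-door (19177).

WHY.  `KrizLiThreeAutomatic` (this seat, p744748) made Kriz–Li's hypothesis (3) (the additive primes `ℓ ≠ p`) automatic at `p ≥ 5`.
Hypothesis (1) — «`ψ(p) ≠ 1` and `(ψ⁻¹ω)(p) ≠ 1`» — concerns the prime `p` itself, where the component-group count of (3) is not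
available.  On the (G-ord, `e = 2`) cell the local structure at `p` is explicit instead: `W = C • V^{(p*)}` with `V` good ORDINARY at `p`
(`SchneiderFree.exists_goodOrd_partner_of_subGordTwo_odd`), Serre's Prop. 11 gives `V[p]|_{I_p} ≅ (χ̄_p ∗; 0 𝟙)`, and the twist multiplies by
the Kummer sign `ε(τ) = τ√p*/√p*`.  Hence the character `r` of any rational `p`-line of `W` restricts to `I_p` as `ε` or as `ε·χ̄_p`; since
`ε` takes the value `−1` (`p` ramifies in `ℚ(√p*)`) and `χ̄_p` takes the value `2 ∉ {±1}` (`p ≥ 5`) on `I_p`, both `r` and `r⁻¹χ̄_p` are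
non-trivial on `I_p`.  The sequel `…KrizLiHypothesisOneAutomaticDoor` turns this into `p ∣ f(ψ)` and `p ∣ f(ψ⁻¹ω)`, i.e. hypothesis (1).

WHAT.
* §1 `exists_ordinaryLine_smul_eq_modNCyclotomicCharacter` — Serre's ordinary line WITH ITS CHARACTER: for `V/ℚ` globally minimal, good
  ordinary at `p`, `𝔓 ∣ p` a prime of `\bar ℤ`: `v₀ ≠ 0` in `V[p]` with `τ x − x ∈ ℤ v₀` and **`τ v₀ = χ̄_p(τ) v₀`** for every `τ ∈ I_𝔓` (the
  tree's `exists_line_of_not_dvd_frobeniusTrace_of_mem_primesAbove` plus the determinant argument of `exists_mem_inertia_smul_eq_of_sub_mem_line`,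
  read for an arbitrary inertia element: `det ρ̄ = χ̄_p`, `det_frame_galoisRepTorsion_eq`).
* §2 `intCast_eq_intCast_of_zsmul_eq` (scalars on a point of order `p` are determined mod `p`);
  **`isogenyCharacter_inertia_dichotomy_of_twist`** — for `W = C • V^{(d)}`, `V` good ordinary at `p`, a rational `p`-line `⟨T⟩ ≤ W[p]` with
  character `r` (`σT = r(σ)T`): on `I_𝔓` EITHER `r(τ) = ε(τ)` OR `r(τ) = ε(τ)·χ̄_p(τ)`, `ε(τ) = ±1` the sign of `τ` on `√d` (the twisting
  isomorphism `V(ℚ̄) ≃ W(ℚ̄)` of `Rank1Residual.Additive.exists_addEquiv_geomPoints_of_model_twist_sign`, sign-equivariant along `√d`; the line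
  `ℤ·g⁻¹T ≤ V[p]` is `Γ_ℚ`-stable, so it is Serre's line — character `χ̄_p` — or meets it trivially — inertia acts trivially on it);
  **`exists_mem_inertia_isogenyCharacter_ne_at_p_of_pStar_twist`** — for `d = p*`, `p ≥ 5`: at the prime `𝔓₀ = adicCompletionPrime ℚ v`
  above `p` there are `τ ∈ I_{𝔓₀}` with `r(τ) ≠ 1` and `τ′ ∈ I_{𝔓₀}` with `r(τ′) ≠ χ̄_p(τ′)` (witnesses: the Kummer element
  `Additive.exists_mem_absInertia_smul_geomSqrt_pStar_eq_neg`, and `χ̄_p(τ) = 2` from `exists_mem_inertia_modNCyclotomicCharacter_eq`).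

HONEST FRAMING: UNCONDITIONAL tree theorems (no definition, no named fact, no `sorry`); pure Galois-module statements about elliptic curves;
nothing about BSD is proved; the branch cruxes r2/r3 are untouched; «closes rung: none».
References: [Serre1972] §1.11 Prop. 11 and Cor.; [SilvermanAEC2009] X.5 Cor. 5.4, VII.5.1; [Mazur1978] §5 (p. 148); [KrizLi2019] Thm. 1.20
(pp. 7–8) hypothesis (1); [Lang1983] Ch. 6 Prop. 1.3 (Kummer); [NeukirchANT1999] Ch. II §9 (9.6); this seat p744748 (`KrizLiThreeAutomatic`).
-/

set_option autoImplicit false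
-- `Summit.<P>.<Sub>` repeats `BirchSwinnertonDyer` by the tree's layout convention (D-0017)
set_option linter.dupNamespace false

noncomputable section

open scoped Classical NumberField Matrix

open NumberField IsDedekindDomain IsDedekindDomain.HeightOneSpectrum Field WeierstrassCurve
  Literature.NumberTheory.GaloisRepresentations Literature.NumberTheory.EllipticCurves
  Literature.NumberTheory.EllipticCurves.KrizLi2019

namespace Summit.BirchSwinnertonDyer.BirchSwinnertonDyer.Theorems.SchneiderFreeAdditiveX3.KrizLiOneAutomatic

/-! ### §1 Serre's ordinary line WITH its character: `τ v₀ = χ̄_p(τ) v₀` for every inertia element `τ` -/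

/-- **Serre's ordinary line with its character.**  For `V/ℚ` globally minimal with good ORDINARY reduction at the prime `p` (`p ∤ a_p`),
`v` the place of `ℚ` at `p` and `𝔓` any prime of `\bar ℤ` above it: there is `v₀ ≠ 0` in `V[p]` such that every `τ` of the inertia group
`I_𝔓` satisfies `τ x − x ∈ ℤ v₀` for all `x ∈ V[p]` (Serre's line `X_p`, inertia trivial on `V[p]/X_p`) and **`τ v₀ = χ̄_p(τ) v₀`** (the
character of `X_p` is the cyclotomic character: `det ρ̄_{V,p} = χ̄_p` by the Weil pairing, read in a frame — the argument of the tree's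
`exists_mem_inertia_smul_eq_of_sub_mem_line`, for an arbitrary inertia element).
[cite: Serre1972, §1.11 Prop. 11 and Cor. (a) ("χ_X = θ_{p−1}^e", "l'image de I_p … (χ ∗; 0 1)")] [cite: SilvermanAEC2009, III.8.1 (Weil pairing, det = cyclotomic)] -/
theorem exists_ordinaryLine_smul_eq_modNCyclotomicCharacter (V : WeierstrassCurve ℚ) [V.IsElliptic] [V.IsGloballyMinimal]
    (p : ℕ) [hp : Fact p.Prime] (hgood : V.HasGoodReductionAtPrime p) (hord : ¬ (p : ℤ) ∣ V.frobeniusTrace p)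
    {v : HeightOneSpectrum (𝓞 ℚ)} (hv : ((Rat.HeightOneSpectrum.primesEquiv v : Nat.Primes) : ℕ) = p)
    {𝔓 : Ideal (absIntegers (𝓞 ℚ) ℚ)} (h𝔓 : 𝔓 ∈ v.primesAbove) :
    ∃ v₀ : geomTorsion V (p : ℤ), v₀ ≠ 0 ∧
      (∀ τ ∈ 𝔓.inertia (absoluteGaloisGroup ℚ), ∀ x : geomTorsion V (p : ℤ), ∃ n : ℤ, τ • x - x = n • v₀) ∧
      (∀ τ ∈ 𝔓.inertia (absoluteGaloisGroup ℚ),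
        τ • v₀ = (((modNCyclotomicCharacter ℚ p τ : (ZMod p)ˣ) : ZMod p).val : ℤ) • v₀) := by
  letI : Module (ZMod p) (geomTorsion V (p : ℤ)) := AddSubgroup.torsionBy.zmodModule
  have hpP : p.Prime := hp.out
  haveI : NeZero p := ⟨hpP.ne_zero⟩
  have hΔ : ¬ (p : ℤ) ∣ minimalDiscriminantInt V := V.not_dvd_minimalDiscriminantInt_of_hasGoodReductionAtPrime' p hgood
  obtain ⟨v₀, hv₀, hline⟩ := exists_line_of_not_dvd_frobeniusTrace_of_mem_primesAbove (W := V) p hΔ hord hv h𝔓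
  have hzmod : ∀ (b : ZMod p) (x : geomTorsion V (p : ℤ)), b • x = ((b.val : ℕ) : ℤ) • x := by
    intro b x
    rw [natCast_zsmul, ← Nat.cast_smul_eq_nsmul (ZMod p), ZMod.natCast_zmod_val]
  refine ⟨v₀, hv₀, fun τ hτ x ↦ ?_, fun τ hτ ↦ ?_⟩
  · obtain ⟨b, hb⟩ := hline τ hτ x
    exact ⟨((b.val : ℕ) : ℤ), by rw [hb, hzmod]⟩
  · -- in a frame: `det Φ(ρ̄ τ) = χ̄_p(τ)`, and `Φ(ρ̄ τ)` is `(1 0; b c)` with `τ v₀ = c v₀`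
    obtain ⟨e, Φ, he, -, -, -, -⟩ := exists_frame_galoisRepTorsion_rat V p
    obtain ⟨b₀, hb₀⟩ := hline τ hτ v₀
    set c : ZMod p := 1 + b₀ with hc
    have hτv : τ • v₀ = c • v₀ := by rw [hc, add_smul, one_smul, ← hb₀, add_sub_cancel]
    suffices hca : c = ((modNCyclotomicCharacter ℚ p τ : (ZMod p)ˣ) : ZMod p) by
      rw [hτv, hca, hzmod]
    have hev₀ : e v₀ ≠ 0 := fun h0 ↦ hv₀ (e.injective (h0.trans (map_zero e).symm))
    have hg : ((Φ (galoisRepTorsion V p τ) : GL (Fin 2) (ZMod p)) :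
        Matrix (Fin 2) (Fin 2) (ZMod p)) *ᵥ e v₀ = c • e v₀ := by
      rw [← he, ← ZMod.map_smul e c v₀, ← hτv]
      rfl
    have hgq : ∀ w : Fin 2 → ZMod p, ∃ b : ZMod p, ((Φ (galoisRepTorsion V p τ) :
        GL (Fin 2) (ZMod p)) : Matrix (Fin 2) (Fin 2) (ZMod p)) *ᵥ w - w = b • e v₀ := by
      intro w
      obtain ⟨b, hb⟩ := hline τ hτ (e.symm w)
      refine ⟨b, ?_⟩
      have h1 := congrArg e hb
      rw [map_sub, ZMod.map_smul e b v₀, AddEquiv.apply_symm_apply] at h1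
      have h2 : e (τ • e.symm w) = ((Φ (galoisRepTorsion V p τ) : GL (Fin 2) (ZMod p)) :
          Matrix (Fin 2) (Fin 2) (ZMod p)) *ᵥ w := by
        rw [show τ • e.symm w = Multiplicative.toAdd (galoisRepTorsion V p τ) (e.symm w) from rfl, he,
          AddEquiv.apply_symm_apply]
      rw [← h1, h2]
    have h1 := det_eq_of_sub_mem_line hev₀ hg hgq
    rw [← h1, det_frame_galoisRepTorsion_eq V p e Φ he τ, modPCyclotomicCharacterZMod_eq_modNCyclotomicCharacter]

/-! ### §2 The isogeny character of a rational `p`-line of a quadratic twist `W = C • V^{(d)}` on the inertia at `p` -/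

open Summit.BirchSwinnertonDyer.Rank1Residual.Additive Literature.NumberTheory.EllipticCurves.Rank1Residual in
/-- Scalars acting equally on a non-zero `p`-torsion point agree modulo `p` (the point has order exactly `p`). [folklore] -/
theorem intCast_eq_intCast_of_zsmul_eq {W : WeierstrassCurve ℚ} [W.IsElliptic] {p : ℕ} [hp : Fact p.Prime]
    {T : geomTorsion W (p : ℤ)} (hT0 : T ≠ 0) {a b : ℤ} (h : a • T = b • T) : (a : ZMod p) = (b : ZMod p) := by
  have hpT : p • T = 0 := Subtype.ext (by
    rw [AddSubgroupClass.coe_nsmul, ← natCast_zsmul]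
    exact (mem_geomTorsion_iff W (p : ℤ) (T : geomPoints W)).mp T.2)
  have hord : addOrderOf T = p := addOrderOf_eq_prime hpT hT0
  have h0 : (b - a) • T = 0 := by rw [sub_smul, h, sub_self]
  have hdvd : (p : ℤ) ∣ b - a := by rw [← hord]; exact (addOrderOf_dvd_iff_zsmul_eq_zero).mpr h0
  exact (ZMod.intCast_eq_intCast_iff_dvd_sub a b p).mpr hdvd

open Summit.BirchSwinnertonDyer.Rank1Residual.Additive Literature.NumberTheory.EllipticCurves.Rank1Residual in
/-- **The isogeny character of a rational `p`-line of a quadratic twist of a good ordinary curve, on the inertia at `p`: `ε` or `ε·χ̄_p`.**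
Let `V/ℚ` be globally minimal with good ORDINARY reduction at `p`, `W = C • V^{(d)}` (`d ≠ 0`), `⟨T⟩ ≤ W[p]` a `Γ_ℚ`-stable line with
isogeny character `r` (`σT = r(σ)T`), `𝔓 ∣ p` a prime of `\bar ℤ`.  Then EITHER for every `τ ∈ I_𝔓`: `r(τ) = 1` if `τ√d = √d` and `r(τ) = −1`
if `τ√d = −√d`, OR for every `τ ∈ I_𝔓`: `r(τ) = χ̄_p(τ)` if `τ√d = √d` and `r(τ) = −χ̄_p(τ)` if `τ√d = −√d`.  Proof: along the twisting
isomorphism `g : V(ℚ̄) ≃ W(ℚ̄)` (`exists_addEquiv_geomPoints_of_model_twist_sign`: `g(σx) = ±σ g(x)`, the sign being that of `σ` on `√d`) the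
line `ℤ·g⁻¹T ≤ V[p]` is `Γ_ℚ`-stable; by §1 it is Serre's line (inertia acts by `χ̄_p`) or meets it trivially (inertia acts trivially, since
`τx − x` lies in both lines); reading back through `g` multiplies by the sign.
[cite: Serre1972, §1.11 Prop. 11 and Cor.] [cite: SilvermanAEC2009, X.5 Cor. 5.4 (the twisting isomorphism)] [cite: Mazur1978, §5 (p. 148)] -/
theorem isogenyCharacter_inertia_dichotomy_of_twist (V W : WeierstrassCurve ℚ) [V.IsElliptic] [V.IsGloballyMinimal]
    [W.IsElliptic] (p : ℕ) [hp : Fact p.Prime] {d : ℚ} (hd : d ≠ 0)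
    (hCW : ∃ C : VariableChange ℚ, C • V.quadraticTwist d = W)
    (hgood : V.HasGoodReductionAtPrime p) (hord : ¬ (p : ℤ) ∣ V.frobeniusTrace p)
    {v : HeightOneSpectrum (𝓞 ℚ)} (hv : ((Rat.HeightOneSpectrum.primesEquiv v : Nat.Primes) : ℕ) = p)
    {𝔓 : Ideal (absIntegers (𝓞 ℚ) ℚ)} (h𝔓 : 𝔓 ∈ v.primesAbove)
    {T : geomTorsion W (p : ℤ)} (hT0 : T ≠ 0) {r : absoluteGaloisGroup ℚ →* (ZMod p)ˣ}
    (hr : ∀ σ : absoluteGaloisGroup ℚ, σ • T = ((r σ : (ZMod p)ˣ) : ZMod p).val • T) :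
    (∀ τ ∈ 𝔓.inertia (absoluteGaloisGroup ℚ),
        (τ • geomSqrt d = geomSqrt d → ((r τ : (ZMod p)ˣ) : ZMod p) = 1) ∧
        (τ • geomSqrt d = -geomSqrt d → ((r τ : (ZMod p)ˣ) : ZMod p) = -1)) ∨
    (∀ τ ∈ 𝔓.inertia (absoluteGaloisGroup ℚ),
        (τ • geomSqrt d = geomSqrt d →
          ((r τ : (ZMod p)ˣ) : ZMod p) = ((modNCyclotomicCharacter ℚ p τ : (ZMod p)ˣ) : ZMod p)) ∧
        (τ • geomSqrt d = -geomSqrt d →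
          ((r τ : (ZMod p)ˣ) : ZMod p) = -((modNCyclotomicCharacter ℚ p τ : (ZMod p)ˣ) : ZMod p))) := by
  have hpP : p.Prime := hp.out
  -- the twisting isomorphism `g : V(ℚ̄) ≃+ W(ℚ̄)`, sign-equivariant along `√d`
  obtain ⟨g, hgpos, hgneg⟩ := exists_addEquiv_geomPoints_of_model_twist_sign V hd hCW
  -- `x = g⁻¹ T ∈ V[p]`
  set x : geomPoints V := g.symm (T : geomPoints W) with hxdef
  have hgx : g x = (T : geomPoints W) := by rw [hxdef, AddEquiv.apply_symm_apply]
  have hpT : (p : ℤ) • (T : geomPoints W) = 0 := (mem_geomTorsion_iff W (p : ℤ) (T : geomPoints W)).mp T.2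
  have hx : x ∈ geomTorsion V (p : ℤ) := by
    refine (mem_geomTorsion_iff V (p : ℤ) x).mpr (g.injective ?_)
    rw [map_zsmul, hgx, hpT, map_zero]
  set xT : geomTorsion V (p : ℤ) := ⟨x, hx⟩ with hxTdef
  have hxT0 : xT ≠ 0 := by
    intro h0
    apply hT0
    have h1 : x = 0 := congrArg Subtype.val h0
    exact Subtype.ext (by rw [← hgx, h1, map_zero]; rfl)
  -- how `σ` acts on `x`: `σ x = ± r(σ) x`
  have hrT : ∀ σ : absoluteGaloisGroup ℚ, σ • (T : geomPoints W) = (((r σ : (ZMod p)ˣ) : ZMod p).val : ℤ) • (T : geomPoints W) := by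
    intro σ
    have h := congrArg (fun R : geomTorsion W (p : ℤ) => (R : geomPoints W)) (hr σ)
    simpa only [AddSubgroup.torsionBy.coe_smul, AddSubgroupClass.coe_nsmul, natCast_zsmul] using h
  have hxpos : ∀ σ : absoluteGaloisGroup ℚ, σ • geomSqrt d = geomSqrt d →
      σ • x = (((r σ : (ZMod p)ˣ) : ZMod p).val : ℤ) • x := by
    intro σ hσ
    apply g.injective
    rw [hgpos σ hσ, map_zsmul, hgx, hrT σ]
  have hxneg : ∀ σ : absoluteGaloisGroup ℚ, σ • geomSqrt d = -geomSqrt d →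
      σ • x = -((((r σ : (ZMod p)ˣ) : ZMod p).val : ℤ) • x) := by
    intro σ hσ
    apply g.injective
    have h := hgneg σ hσ x
    rw [hgx, hrT σ] at h
    rw [map_neg, map_zsmul, hgx, ← h]
  -- hence `ℤ x` is `Γ_ℚ`-stable
  have hstab : ∀ σ : absoluteGaloisGroup ℚ, σ • xT ∈ AddSubgroup.zmultiples xT := by
    intro σ
    rcases map_geomSqrt (absoluteGaloisGroup.toAlgEquiv ℚ σ) d with h | h
    · refine ⟨(((r σ : (ZMod p)ˣ) : ZMod p).val : ℤ), Subtype.ext ?_⟩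
      have e1 : (((((r σ : (ZMod p)ˣ) : ZMod p).val : ℤ) • xT : geomTorsion V (p : ℤ)) : geomPoints V) =
          (((r σ : (ZMod p)ˣ) : ZMod p).val : ℤ) • x := AddSubgroupClass.coe_zsmul _ _
      have e2 : ((σ • xT : geomTorsion V (p : ℤ)) : geomPoints V) = σ • x := AddSubgroup.torsionBy.coe_smul σ xT
      rw [e1, e2, hxpos σ h]
    · refine ⟨-(((r σ : (ZMod p)ˣ) : ZMod p).val : ℤ), Subtype.ext ?_⟩
      have e1 : (((-(((r σ : (ZMod p)ˣ) : ZMod p).val : ℤ)) • xT : geomTorsion V (p : ℤ)) : geomPoints V) =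
          (-(((r σ : (ZMod p)ˣ) : ZMod p).val : ℤ)) • x := AddSubgroupClass.coe_zsmul _ _
      have e2 : ((σ • xT : geomTorsion V (p : ℤ)) : geomPoints V) = σ • x := AddSubgroup.torsionBy.coe_smul σ xT
      rw [e1, e2, hxneg σ h, neg_zsmul]
  -- Serre's ordinary line of `V` at `𝔓`, with its character
  obtain ⟨v₀, hv₀, hline, hchar⟩ := exists_ordinaryLine_smul_eq_modNCyclotomicCharacter V p hgood hord hv h𝔓
  have hcardx : Nat.card (AddSubgroup.zmultiples xT) = p := by
    have hpx : p • xT = 0 := Subtype.ext (by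
      rw [AddSubgroupClass.coe_nsmul, ← natCast_zsmul]; exact (mem_geomTorsion_iff V (p : ℤ) x).mp hx)
    rw [Nat.card_zmultiples, addOrderOf_eq_prime hpx hxT0]
  have hcardv : Nat.card (AddSubgroup.zmultiples v₀) = p := by
    have hpv₀ : p • v₀ = 0 := Subtype.ext (by
      rw [AddSubgroupClass.coe_nsmul, ← natCast_zsmul]; exact (mem_geomTorsion_iff V (p : ℤ) (v₀ : geomPoints V)).mp v₀.2)
    rw [Nat.card_zmultiples, addOrderOf_eq_prime hpv₀ hv₀]
  -- the action of inertia on `xT`: by `χ̄_p` (on Serre's line) or trivially (off it)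
  have key : (∀ τ ∈ 𝔓.inertia (absoluteGaloisGroup ℚ), τ • xT = xT) ∨
      (∀ τ ∈ 𝔓.inertia (absoluteGaloisGroup ℚ),
        τ • xT = (((modNCyclotomicCharacter ℚ p τ : (ZMod p)ˣ) : ZMod p).val : ℤ) • xT) := by
    rcases line_eq_or_inf_eq_bot hcardx hcardv with heq | hinf
    · right
      intro τ hτ
      have hmem : xT ∈ AddSubgroup.zmultiples v₀ := heq ▸ AddSubgroup.mem_zmultiples xT
      obtain ⟨k, hk⟩ := AddSubgroup.mem_zmultiples_iff.mp hmem
      rw [← hk, show τ • (k • v₀) = k • (τ • v₀) from map_zsmul (DistribSMul.toAddMonoidHom _ τ) k v₀, hchar τ hτ,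
        ← mul_zsmul, ← mul_zsmul, mul_comm]
    · left
      intro τ hτ
      obtain ⟨n, hn⟩ := hline τ hτ xT
      have h1 : τ • xT - xT ∈ AddSubgroup.zmultiples v₀ := hn ▸ AddSubgroup.zsmul_mem _ (AddSubgroup.mem_zmultiples v₀) n
      have h2 : τ • xT - xT ∈ AddSubgroup.zmultiples xT :=
        AddSubgroup.sub_mem _ (hstab τ) (AddSubgroup.mem_zmultiples xT)
      have h3 : τ • xT - xT ∈ AddSubgroup.zmultiples xT ⊓ AddSubgroup.zmultiples v₀ := ⟨h2, h1⟩
      rw [hinf, AddSubgroup.mem_bot] at h3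
      exact sub_eq_zero.mp h3
  -- read back on `T = g x`
  have back : ∀ τ : absoluteGaloisGroup ℚ, ∀ m : ℤ, τ • xT = m • xT →
      (τ • geomSqrt d = geomSqrt d → ((r τ : (ZMod p)ˣ) : ZMod p) = (m : ZMod p)) ∧
      (τ • geomSqrt d = -geomSqrt d → ((r τ : (ZMod p)ˣ) : ZMod p) = -(m : ZMod p)) := by
    intro τ m hm
    have hmx : τ • x = m • x := by
      have h := congrArg Subtype.val hm
      rwa [AddSubgroup.torsionBy.coe_smul, AddSubgroupClass.coe_zsmul] at h
    have hrval : (((((r τ : (ZMod p)ˣ) : ZMod p).val : ℤ)) : ZMod p) = ((r τ : (ZMod p)ˣ) : ZMod p) := by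
      rw [Int.cast_natCast, ZMod.natCast_zmod_val]
    constructor
    · intro hτ
      have h1 : (((r τ : (ZMod p)ˣ) : ZMod p).val : ℤ) • (T : geomPoints W) = m • (T : geomPoints W) := by
        rw [← hrT τ, ← hgx, ← hgpos τ hτ, hmx, map_zsmul]
      have h2 : (((r τ : (ZMod p)ˣ) : ZMod p).val : ℤ) • T = m • T :=
        Subtype.ext (by rw [AddSubgroupClass.coe_zsmul, AddSubgroupClass.coe_zsmul]; exact h1)
      rw [← hrval]
      exact intCast_eq_intCast_of_zsmul_eq hT0 h2
    · intro hτ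
      have h1 : (((r τ : (ZMod p)ˣ) : ZMod p).val : ℤ) • (T : geomPoints W) = (-m) • (T : geomPoints W) := by
        have h := hgneg τ hτ x
        rw [hgx, hrT τ, hmx, map_zsmul, hgx] at h
        rw [neg_zsmul, h, neg_neg]
      have h2 : (((r τ : (ZMod p)ˣ) : ZMod p).val : ℤ) • T = (-m) • T :=
        Subtype.ext (by rw [AddSubgroupClass.coe_zsmul, AddSubgroupClass.coe_zsmul]; exact h1)
      rw [← hrval, ← Int.cast_neg]
      exact intCast_eq_intCast_of_zsmul_eq hT0 h2
  rcases key with hfix | hcyc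
  · left
    intro τ hτ
    have h := back τ 1 (by rw [one_zsmul]; exact hfix τ hτ)
    simpa only [Int.cast_one] using h
  · right
    intro τ hτ
    have h := back τ _ (hcyc τ hτ)
    simpa only [Int.cast_natCast, ZMod.natCast_zmod_val] using h

open Summit.BirchSwinnertonDyer.Rank1Residual.Additive in
/-- **On the (G-ord, `e = 2`) presentation `W = C • V^{(p*)}` (`V` globally minimal good ordinary at `p`, `p ≥ 5`) BOTH Jordan–Hölder
characters of `W[p]` along a rational `p`-line are RAMIFIED at `p`:** for the isogeny character `r` of any `Γ_ℚ`-stable line `⟨T⟩ ≤ W[p]`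
there are, in the inertia group of the prime `𝔓₀ = adicCompletionPrime ℚ v` above `p` (`v` the place at `p`), an element `τ` with
`r(τ) ≠ 1` and an element `τ′` with `r(τ′) ≠ χ̄_p(τ′)`.  Witnesses: the Kummer element `τ₋` (`τ₋√p* = −√p*`, `p` ramifies in `ℚ(√p*)`;
`Additive.exists_mem_absInertia_smul_geomSqrt_pStar_eq_neg`, `I_{𝔓₀} = res(absInertia ℚ_p)`) and `τ₂` with `χ̄_p(τ₂) = 2`
(`exists_mem_inertia_modNCyclotomicCharacter_eq`); by the dichotomy `r|_{I} ∈ {ε, ε·χ̄_p}` and `2 ∉ {0, ±1} (mod p)` for `p ≥ 5`.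
[cite: Serre1972, §1.11 Prop. 11] [cite: Lang1983, Ch. 6 Prop. 1.3] [cite: KrizLi2019, Thm. 1.20 hypothesis (1) (p. 7)]
[cite: NeukirchANT1999, Ch. II §9 Prop. (9.6)] -/
theorem exists_mem_inertia_isogenyCharacter_ne_at_p_of_pStar_twist (V W : WeierstrassCurve ℚ) [V.IsElliptic]
    [V.IsGloballyMinimal] [W.IsElliptic] (p : ℕ) [hp : Fact p.Prime] (h5 : 5 ≤ p)
    (hCW : ∃ C : VariableChange ℚ, C • V.quadraticTwist ((-1 : ℚ) ^ (p / 2) * p) = W)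
    (hgood : V.HasGoodReductionAtPrime p) (hord : ¬ (p : ℤ) ∣ V.frobeniusTrace p)
    {T : geomTorsion W (p : ℤ)} (hT0 : T ≠ 0) {r : absoluteGaloisGroup ℚ →* (ZMod p)ˣ}
    (hr : ∀ σ : absoluteGaloisGroup ℚ, σ • T = ((r σ : (ZMod p)ˣ) : ZMod p).val • T) :
    ∃ (v : HeightOneSpectrum (𝓞 ℚ)), Rat.HeightOneSpectrum.natGenerator v = p ∧
      ∃ 𝔓 ∈ v.primesAbove,
        (∃ τ ∈ 𝔓.inertia (absoluteGaloisGroup ℚ), r τ ≠ 1) ∧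
        (∃ τ ∈ 𝔓.inertia (absoluteGaloisGroup ℚ),
          ((r τ : (ZMod p)ˣ) : ZMod p) ≠ ((modNCyclotomicCharacter ℚ p τ : (ZMod p)ˣ) : ZMod p)) := by
  have hpP : p.Prime := hp.out
  have hp2 : p ≠ 2 := by omega
  have hp3 : p ≠ 3 := by omega
  haveI : NeZero p := ⟨hpP.ne_zero⟩
  have hd : ((-1 : ℚ) ^ (p / 2) * p) ≠ 0 := mul_ne_zero (pow_ne_zero _ (by norm_num)) (by exact_mod_cast hpP.ne_zero)
  -- the place `v` of `ℚ` at `p` and the chosen prime `𝔓₀` above it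
  obtain ⟨v, hv⟩ : ∃ v : HeightOneSpectrum (𝓞 ℚ), Rat.HeightOneSpectrum.primesEquiv v = ⟨p, hpP⟩ :=
    ⟨(Rat.HeightOneSpectrum.primesEquiv (R := 𝓞 ℚ)).symm ⟨p, hpP⟩, Equiv.apply_symm_apply _ _⟩
  have hvp : ((Rat.HeightOneSpectrum.primesEquiv v : Nat.Primes) : ℕ) = p := by rw [hv]
  have hpv : ((p : ℕ) : 𝓞 ℚ) ∈ v.asIdeal := by
    have h := Mazur1978.natCast_natGenerator_mem_asIdeal v
    rwa [show Rat.HeightOneSpectrum.natGenerator v = p from hvp] at h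
  set 𝔓 := adicCompletionPrime ℚ v with h𝔓def
  have h𝔓 : 𝔓 ∈ v.primesAbove := adicCompletionPrime_mem_primesAbove ℚ v
  refine ⟨v, hvp, 𝔓, h𝔓, ?_⟩
  -- two useful facts in `𝔽_p`, `p ≥ 5`
  have hne2 : ∀ u : (ZMod p)ˣ, -(u : ZMod p) ≠ (u : ZMod p) := by
    intro u h
    have h2 : (2 : ZMod p) * (u : ZMod p) = 0 := by rw [two_mul]; nth_rewrite 1 [← h]; rw [neg_add_cancel]
    rcases mul_eq_zero.mp h2 with h0 | h0
    · have : (p : ℤ) ∣ 2 := by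
        rw [← ZMod.intCast_zmod_eq_zero_iff_dvd]; exact_mod_cast h0
      have h' : p ∣ 2 := by exact_mod_cast this
      exact hp2 ((Nat.prime_dvd_prime_iff_eq hpP Nat.prime_two).mp h')
    · exact u.ne_zero h0
  have h2ne : ((2 : ℕ) : ZMod p) ≠ 1 ∧ ((2 : ℕ) : ZMod p) ≠ -1 := by
    constructor
    · intro h
      have h1 : (((2 : ℕ) : ℤ) : ZMod p) = ((1 : ℤ) : ZMod p) := by exact_mod_cast h
      rw [ZMod.intCast_eq_intCast_iff_dvd_sub] at h1
      have h3 : (p : ℤ) ∣ 1 := by simpa using h1.neg_right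
      exact hpP.one_lt.ne' (Nat.dvd_one.mp (by exact_mod_cast h3))
    · intro h
      have h1 : (((2 : ℕ) : ℤ) : ZMod p) = ((-1 : ℤ) : ZMod p) := by exact_mod_cast h
      rw [ZMod.intCast_eq_intCast_iff_dvd_sub] at h1
      have h3 : (p : ℤ) ∣ 3 := by simpa using h1.neg_right
      have h4 : p ∣ 3 := by exact_mod_cast h3
      exact hp3 ((Nat.prime_dvd_prime_iff_eq hpP Nat.prime_three).mp h4)
  -- the Kummer element: `τm ∈ I_𝔓₀` with `τm √p* = −√p*`
  obtain ⟨σm, hσm, hσmneg⟩ := exists_mem_absInertia_smul_geomSqrt_pStar_eq_neg p hp2 hpv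
  have hτm : absGaloisRestrict ℚ (v.adicCompletion ℚ) σm ∈ 𝔓.inertia (absoluteGaloisGroup ℚ) := by
    rw [h𝔓def, inertia_adicCompletionPrime_eq_map_absInertia]
    exact Subgroup.mem_map_of_mem _ hσm
  -- the cyclotomic element: `τt ∈ I_𝔓₀` with `χ̄_p(τt) = 2`
  have hcop : Nat.Coprime 2 p := (Nat.coprime_primes Nat.prime_two hpP).mpr hp2.symm
  obtain ⟨τt, hτt, hτtχ⟩ := exists_mem_inertia_modNCyclotomicCharacter_eq (m := p) (p := p) (k := 0) (d := 1)
    (by rw [zero_add, pow_one, mul_one]) hpP.not_dvd_one (show Rat.HeightOneSpectrum.natGenerator v = p from hvp) h𝔓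
    (a := ZMod.unitOfCoprime 2 hcop) (Subsingleton.elim _ _)
  have hχt : ((modNCyclotomicCharacter ℚ p τt : (ZMod p)ˣ) : ZMod p) = ((2 : ℕ) : ZMod p) := by
    rw [hτtχ, ZMod.coe_unitOfCoprime]
  -- `τt √p* = ± √p*`
  have hτtsq : τt • geomSqrt ((-1 : ℚ) ^ (p / 2) * p) = geomSqrt ((-1 : ℚ) ^ (p / 2) * p) ∨
      τt • geomSqrt ((-1 : ℚ) ^ (p / 2) * p) = -geomSqrt ((-1 : ℚ) ^ (p / 2) * p) :=
    map_geomSqrt (absoluteGaloisGroup.toAlgEquiv ℚ τt) _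
  rcases isogenyCharacter_inertia_dichotomy_of_twist V W p hd hCW hgood hord hvp h𝔓 hT0 hr with hA | hB
  · -- Case A: `r = sign` on inertia
    refine ⟨⟨_, hτm, fun h1 => ?_⟩, ⟨τt, hτt, fun h => ?_⟩⟩
    · have h := (hA _ hτm).2 hσmneg
      rw [h1, Units.val_one] at h
      exact hne2 1 (by rw [Units.val_one]; exact h.symm)
    · rcases hτtsq with hs | hs
      · rw [(hA τt hτt).1 hs, hχt] at h; exact h2ne.1 h.symm
      · rw [(hA τt hτt).2 hs, hχt] at h; exact h2ne.2 h.symm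
  · -- Case B: `r = sign · χ̄_p` on inertia
    refine ⟨⟨τt, hτt, fun h1 => ?_⟩, ⟨_, hτm, fun h => ?_⟩⟩
    · rcases hτtsq with hs | hs
      · have h := (hB τt hτt).1 hs
        rw [h1, Units.val_one, hχt] at h; exact h2ne.1 h.symm
      · have h := (hB τt hτt).2 hs
        rw [h1, Units.val_one, hχt] at h
        apply h2ne.2
        rw [← neg_neg ((2 : ℕ) : ZMod p), ← h]
    · rw [(hB _ hτm).2 hσmneg] at h
      exact hne2 _ h

end Summit.BirchSwinnertonDyer.BirchSwinnertonDyer.Theorems.SchneiderFreeAdditiveX3.KrizLiOneAutomatic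

end
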